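import Literature.MathematicalPhysics.QuantumFieldTheory.ConstructiveQFTBalabanRG
import Literature.MathematicalPhysics.QuantumLattice.LatticeGaugeDLRProofs
import HarnessLib

/-!
# Haar iterates of the Wilson density: the block RG step as an explicit integral, and
single-scheme uniform UV stability by Haar invariance

Companion of prelude A18 `Literature/MathematicalPhysics/QuantumLattice/BalabanRG.lean` and of the
statement file `Literature/MathematicalPhysics/QuantumFieldTheory/ConstructiveQFTBalabanRG.lean`
(constructive-qft.S20). Everything here is proved; no named fact is introduced.

## Why this file exists

The statement file records the single-scheme predicates
`BlockRGScheme.HasUniformUVStability(AE) sch` ("API only") and asserts in their docstrings, without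
proof, the folklore fact (review r02500B) that for ONE block RG scheme whose effective densities are
the *normalised block RG iterates* of the Wilson density (`BlockRGScheme.IsRGIterateWith E`) the
`k`-uniform two-sided bounds `e^{-c|Λ|} ≤ ρ_k(Λ, V) ≤ e^{C|Λ|}` are an elementary consequence of Haar
invariance; it also asserts that schemes satisfying `IsRGIterateWith E` exist, so that the cutoff-indexed
propositions `BalabanUVStability3/4` are not vacuous. The predicates themselves are not theorems about
every scheme (`BlockRGScheme.not_forall_hasUniformUVStability(AE)`, file
`ConstructiveQFTBalabanRGProofs`). This file proves the positive statement in closed form: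

* `BlockRGScheme.exists_isRGIterateWith_and_hasUniformUVStability` — for every block size `M ≥ 2`,
  every continuous representation `ρ : G →* M_N(ℂ)` of a compact second-countable group `G` and every
  sequence of running couplings `g` there is a scheme `sch` with `sch.M = M`, `sch.ρ = ρ`,
  `sch.couplings = g`, `sch.IsRGIterateWith E` for explicit normalisations `E`, and
  `sch.HasUniformUVStability` (pointwise, hence also `sch.HasUniformUVStabilityAE`).

The witness is the **Haar-iterate scheme** `BlockRGScheme.haarIterate M hM ρ g`, whose densities are
`rgIterate M (wilsonBoltzmannWeight ρ g₀⁻²) k Λ` (converted to `ℝ`), with the theorems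
`BlockRGScheme.haarIterate_isRGIterateWith` and `BlockRGScheme.haarIterate_hasUniformUVStability`.
The stability constant is `K = g₀⁻² (N + 3C)(1 + d) #{i < j}` with `|Re tr ρ| ≤ C`; it blows up like
`g₀⁻²`, in accordance with the remark in the statement file that Bałaban's theorems (CMP 102 (1985)
Thm. 1, CMP 122 (1989) Thm. 1: uniformity in the *cutoff*, with cutoff-dependent bare coupling) are
NOT captured by the single-scheme predicate. Nothing here is Bałaban's theorem.

## Content

1. Block lines (`lineEdge`, `lineEdge_inj`, `axialBlockHolonomy_glueWith`): the `L` fine edges of the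
   straight line representing a coarse edge, injectivity, and the block holonomy of a glued
   configuration (supported on `Λ`).
2. The first-link lift `firstLift L Λ h` of a coarse field `h` (value `h b` on the first edge of the
   line of `b ∈ Λ`, `1` elsewhere): it is multiplicative, supported on `fineEdges L Λ`, and
   `axialBlockHolonomy L (firstLift L Λ h * U) = glueWith Λ h 1 * axialBlockHolonomy L U`
   (`axialBlockHolonomy_firstLift_mul`) — left-multiplying the first link multiplies the ordered
   product on the left.
3. Haar invariance: left/right translations preserve `Haar^{⊗Λ}` (`measurePreserving_mul_left_pi`,
   `measurePreserving_mul_right_pi`, from the two-sided invariance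
   `measurePreserving_mul_mul_inv_haarProbability` of `LatticeGaugeDLRProofs`), hence left
   multiplication by a first-link lift preserves `freeHaarConfig (fineEdges L Λ)`
   (`measurePreserving_firstLift_mul`).
4. **The block RG step as an explicit integral** (`blockStepDensity`,
   `map_axialBlockHolonomy_withDensity`): for every measurable weight `w ≥ 0` on fine configurations,
   the image of `w · dU` (`dU = freeHaarConfig (fineEdges L Λ)`) under `axialBlockHolonomy L` is
   `D · dV` (`dV = freeHaarConfig Λ`) with the everywhere-defined density
   `D(V) = ∫ w (firstLift L Λ (V Ū⁻¹) · U) dU`, `Ū = axialBlockHolonomy L U` — the rigorous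
   free-boundary axial-gauge form of `ρ_{k+1}(V) = ∫ ∏_{b ∈ Λ} δ(V_b⁻¹ Ū_b) ρ_k(U) dU`
   (Bałaban CMP 109 (1987) (0.1)–(0.2); prelude A18 `IsBlockRGStepOf`). Proof: invariance of `dU`
   under first-link lifts, averaging over the lift against `Haar^{⊗Λ}`, Tonelli, and right
   invariance of `Haar^{⊗Λ}` to recentre the translation at `Ū⁻¹`. Mass is preserved
   (`lintegral_blockStepDensity`).
5. Propagation through the step with the SAME constant (`le_blockStepDensity`, `blockStepDensity_le`,
   `blockStepDensity_osc`): a uniform lower/upper bound of `w` passes to `D`, and if changing the fine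
   field on a finite edge set `F` changes `w` by at most `e^{K|F|}`, the same holds for `D` as a
   function of the coarse field (changing `V` on `F` only moves the first links over `F`). A density
   reading only `Λ`, with this oscillation bound and total mass `1`, is pinched between `e^{∓K|Λ|}`
   everywhere (`bounds_of_osc_of_lintegral_eq_one`).
6. The Wilson weight `wilsonBoltzmannWeight ρ β Λ U = exp (-β S_Λ(U))` (as `ℝ≥0∞`): plaquette counting
   `#plaquettesTouching F ≤ (1 + d) #{i<j} #F` (`card_plaquettesTouching_le`), locality of the
   plaquette observable, `|S_Λ(U) - S_Λ(U')| ≤ 2C #plaquettesTouching F` when `U = U'` off `F`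
   (`abs_wilsonBoundaryAction_sub_le`), `|S_Λ| ≤ (N + C) #plaquettesTouching Λ`; hence the starting
   weight is measurable, pinched and has the oscillation bound, all with `K` as above
   (`wilsonBoltzmannWeight_spec`; `|Re tr ρ(U_p)| ≤ C` from continuity of `ρ` on the compact group,
   `exists_forall_abs_plaquetteObs_le`).
7. The normalised iterates `rgIterate M w₀ k Λ` (recursion on `k`, volume-indexed), their invariants
   by induction (`rgIterate_spec`), total mass one from step `1` on (`lintegral_rgIterate_succ`), the
   recursion identity (`map_axialBlockHolonomy_withDensity_rgIterate`) and the `k`-uniform pointwise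
   bounds (`rgIterate_succ_bounds`); finally the scheme `BlockRGScheme.haarIterate`, its
   normalisations `BlockRGScheme.haarIterateNormalisation` (`E_k(Λ) = -log ∫ ρ_k(fineEdges M Λ, U) dU`)
   and the three theorems above.

Hypotheses: `[SecondCountableTopology G]` (joint measurability of products, Tonelli) and
`Continuous ρ` (measurability and boundedness of the plaquette observables); no smallness or sign
condition on the couplings (`β = g₀⁻² ≥ 0` always).

## References

* T. Bałaban, *Renormalization group approach to lattice gauge field theories. I*, Comm. Math.
  Phys. 109 (1987) 249–301, (0.1)–(0.3) (the block RG recursion; here in the free-boundary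
  axial-gauge form of prelude A18, without small/large-field split or coupling renormalisation).
* T. Bałaban, *Propagators and renormalization transformations for lattice gauge theories. I*,
  Comm. Math. Phys. 95 (1984) 17–40, §1 (1.4)–(1.6) (axial-gauge block link variables as ordered
  products along straight lines).
* T. Bałaban, *Ultraviolet stability of three-dimensional lattice pure gauge field theories*, Comm.
  Math. Phys. 102 (1985) 255–275, Thm. 1 (the shape `e^{-c|Λ|} ≤ ρ_k ≤ e^{C|Λ|}` of UV stability
  bounds — whose cutoff-uniform content is NOT what is proved here).
* E. Seiler, *Gauge Theories as a Problem of Constructive Quantum Field Theory and Statistical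
  Mechanics*, LNP 159 (1982), Ch. 1–2 (bi-invariance of Haar measure in lattice gauge theory; the
  change of variables on single links used in items 3–4 is the standard one).
-/

noncomputable section

open MeasureTheory Filter Topology Finset
open scoped ENNReal

namespace Literature.MathematicalPhysics.QuantumLattice

open Literature.Probability.LatticeModels

variable {d N : ℕ} {G : Type*}

/-! ### Block lines: the fine edges of a straight block line, injectivity -/

/-- The `t`-th fine edge `(L y + t eᵢ, i)` of the straight block line representing the coarse
edge `b = (y, i)` (Bałaban CMP 95 (1984) §1, (1.5)); `blockLine L b` is the list of these for
`t < L` (`blockLine_eq_map_lineEdge`). [folklore] -/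
def lineEdge (L : ℕ) (b : ZdEdge d) (t : ℕ) : ZdEdge d :=
  (blockBase L b.1 + Pi.single b.2 (t : ℤ), b.2)

/-- `blockLine L b` lists the line edges `lineEdge L b t`, `t < L`. [folklore] -/
theorem blockLine_eq_map_lineEdge (L : ℕ) (b : ZdEdge d) :
    blockLine L b = (List.range L).map (lineEdge L b) := rfl

/-- The second component of a line edge is the direction of the coarse edge. [folklore] -/
@[simp] theorem lineEdge_snd (L : ℕ) (b : ZdEdge d) (t : ℕ) : (lineEdge L b t).2 = b.2 := rfl

/-- Line edges of `b` lie on the block line of `b`. [folklore] -/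
theorem lineEdge_mem_blockLine (L : ℕ) (b : ZdEdge d) {t : ℕ} (ht : t < L) :
    lineEdge L b t ∈ blockLine L b :=
  (mem_blockLine_iff L).2 ⟨t, ht, rfl⟩

/-- The coarse edge below a line edge of `b` is `b`. [folklore] -/
theorem coarseEdge_lineEdge (L : ℕ) (b : ZdEdge d) {t : ℕ} (ht : t < L) :
    coarseEdge L (lineEdge L b t) = b :=
  coarseEdge_eq_of_mem_blockLine L (lineEdge_mem_blockLine L b ht)

/-- A line edge of `b` lies over `Λ` iff `b ∈ Λ`. [folklore] -/
theorem lineEdge_mem_fineEdges_iff (L : ℕ) [NeZero L] (Λ : Finset (ZdEdge d)) (b : ZdEdge d)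
    {t : ℕ} (ht : t < L) : lineEdge L b t ∈ fineEdges L Λ ↔ b ∈ Λ := by
  rw [mem_fineEdges_iff, coarseEdge_lineEdge L b ht]

/-- Line edges determine the coarse edge and the position on the line. [folklore] -/
theorem lineEdge_inj {L : ℕ} {b b' : ZdEdge d} {t t' : ℕ} (ht : t < L) (ht' : t' < L)
    (h : lineEdge L b t = lineEdge L b' t') : b = b' ∧ t = t' := by
  have hb : b = b' := by
    rw [← coarseEdge_lineEdge L b ht, ← coarseEdge_lineEdge L b' ht', h]
  subst hb
  refine ⟨rfl, ?_⟩
  have h1 := congrArg (fun e : ZdEdge d => e.1 b.2) h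
  simpa [lineEdge] using h1

/-- The first edge of the line through a line edge `e = lineEdge L b t` is `lineEdge L b 0`. [folklore] -/
theorem lineEdge_coarseEdge_zero (L : ℕ) (b : ZdEdge d) {t : ℕ} (ht : t < L) :
    lineEdge L (coarseEdge L (lineEdge L b t)) 0 = lineEdge L b 0 := by
  rw [coarseEdge_lineEdge L b ht]

section Holonomy

variable [Group G]

/-- The block holonomy as a product over line edges. [folklore] -/
theorem axialBlockHolonomy_apply (L : ℕ) (U : LGConfig d G) (b : ZdEdge d) :
    axialBlockHolonomy L U b = ((List.range L).map fun t => U (lineEdge L b t)).prod := by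
  rw [axialBlockHolonomy, blockLine_eq_map_lineEdge, List.map_map]
  rfl

/-- On a glued configuration `glueWith (fineEdges L Λ) u 1` the block holonomy is the glued
coarse configuration of the line products: for `b ∈ Λ` the ordered product of `u` along the
line of `b`, and `1` off `Λ` (every edge of the line of `b ∉ Λ` lies outside `fineEdges L Λ`). [folklore] -/
theorem axialBlockHolonomy_glueWith (L : ℕ) [NeZero L] (Λ : Finset (ZdEdge d))
    (u : ↥(fineEdges L Λ) → G) :
    axialBlockHolonomy L (glueWith (fineEdges L Λ) u 1) =
      glueWith Λ (fun b : ↥Λ => ((List.range L).map fun t =>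
        glueWith (fineEdges L Λ) u 1 (lineEdge L b t)).prod) 1 := by
  funext b
  rw [axialBlockHolonomy_apply]
  by_cases hb : b ∈ Λ
  · rw [glueWith_apply_mem _ _ _ hb]
  · rw [glueWith_apply_not_mem _ _ _ hb, Pi.one_apply]
    refine List.prod_eq_one fun x hx => ?_
    obtain ⟨t, ht, rfl⟩ := List.mem_map.1 hx
    rw [glueWith_apply_not_mem]
    · rfl
    · rw [lineEdge_mem_fineEdges_iff L Λ b (List.mem_range.1 ht)]
      exact hb

end Holonomy

/-! ### Lifting coarse fields to the first fine links -/

section Lift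

variable [Group G]

/-- Lift a coarse field `h` to the fine lattice along the *first* links of the block lines over
`Λ`: the fine configuration equal to `h (coarseEdge L e)` on the first edge `e = lineEdge L b 0`
of the line of a coarse edge `b ∈ Λ`, and `1` on every other edge. Left multiplication by
`firstLift L Λ h` is the Haar-measure preserving change of variables behind the elementary
single-scheme UV stability bound (review r02500B). [folklore] -/
def firstLift (L : ℕ) (Λ : Finset (ZdEdge d)) (h : LGConfig d G) : LGConfig d G :=
  open Classical in
  fun e => if e = lineEdge L (coarseEdge L e) 0 ∧ coarseEdge L e ∈ Λ then h (coarseEdge L e) else 1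

open Classical in
/-- Unfolding of `firstLift`. [folklore] -/
theorem firstLift_apply (L : ℕ) (Λ : Finset (ZdEdge d)) (h : LGConfig d G) (e : ZdEdge d) :
    firstLift L Λ h e =
      if e = lineEdge L (coarseEdge L e) 0 ∧ coarseEdge L e ∈ Λ then h (coarseEdge L e) else 1 :=
  rfl

/-- On the first edge of the line of `b ∈ Λ` the lift is `h b`. [folklore] -/
theorem firstLift_lineEdge_zero (L : ℕ) [NeZero L] (Λ : Finset (ZdEdge d)) (h : LGConfig d G)
    {b : ZdEdge d} (hb : b ∈ Λ) : firstLift L Λ h (lineEdge L b 0) = h b := by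
  have h0 : 0 < L := Nat.pos_of_ne_zero (NeZero.ne L)
  rw [firstLift_apply, coarseEdge_lineEdge L b h0, if_pos ⟨rfl, hb⟩]

/-- On the later edges of a line the lift is `1`. [folklore] -/
theorem firstLift_lineEdge_succ (L : ℕ) (Λ : Finset (ZdEdge d)) (h : LGConfig d G)
    (b : ZdEdge d) {t : ℕ} (ht : t + 1 < L) : firstLift L Λ h (lineEdge L b (t + 1)) = 1 := by
  rw [firstLift_apply, coarseEdge_lineEdge L b ht, if_neg]
  rintro ⟨h1, -⟩
  exact Nat.succ_ne_zero t (lineEdge_inj ht (by omega) h1).2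

/-- Off `fineEdges L Λ` the lift is `1`. [folklore] -/
theorem firstLift_apply_of_not_mem (L : ℕ) [NeZero L] (Λ : Finset (ZdEdge d)) (h : LGConfig d G)
    {e : ZdEdge d} (he : e ∉ fineEdges L Λ) : firstLift L Λ h e = 1 := by
  rw [firstLift_apply, if_neg]
  rintro ⟨-, h2⟩
  exact he ((mem_fineEdges_iff L Λ e).2 h2)

/-- The lift is multiplicative. [folklore] -/
theorem firstLift_mul (L : ℕ) (Λ : Finset (ZdEdge d)) (h h' : LGConfig d G) :
    firstLift L Λ (h * h') = firstLift L Λ h * firstLift L Λ h' := by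
  funext e
  simp only [firstLift_apply, Pi.mul_apply]
  split_ifs <;> simp

/-- The lift of `1` is `1`. [folklore] -/
@[simp] theorem firstLift_one (L : ℕ) (Λ : Finset (ZdEdge d)) :
    firstLift L Λ (1 : LGConfig d G) = 1 := by
  funext e
  simp [firstLift_apply]

/-- The lift is compatible with inverses. [folklore] -/
theorem firstLift_inv (L : ℕ) (Λ : Finset (ZdEdge d)) (h : LGConfig d G) :
    firstLift L Λ h⁻¹ = (firstLift L Λ h)⁻¹ :=
  eq_inv_of_mul_eq_one_left (by rw [← firstLift_mul, inv_mul_cancel, firstLift_one])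

/-- The lift only reads the coarse field on `Λ`. [folklore] -/
theorem firstLift_congr (L : ℕ) (Λ : Finset (ZdEdge d)) {h h' : LGConfig d G}
    (hh : ∀ b ∈ Λ, h b = h' b) : firstLift L Λ h = firstLift L Λ h' := by
  funext e
  simp only [firstLift_apply]
  split_ifs with hc
  · exact hh _ hc.2
  · rfl

/-- **Key algebraic identity.** Left-multiplying a fine configuration by the lift of `h` multiplies
the block holonomy of every `b ∈ Λ` on the left by `h b` (and leaves it unchanged off `Λ`):
`hol (firstLift h * U) = glueWith Λ h 1 * hol U`, for `L ≥ 1`. [folklore] -/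
theorem axialBlockHolonomy_firstLift_mul (L : ℕ) [NeZero L] (Λ : Finset (ZdEdge d))
    (h U : LGConfig d G) :
    axialBlockHolonomy L (firstLift L Λ h * U) =
      glueWith Λ (fun b : ↥Λ => h b) 1 * axialBlockHolonomy L U := by
  obtain ⟨L', rfl⟩ : ∃ L', L = L' + 1 := ⟨L - 1, (Nat.succ_pred_eq_of_pos (Nat.pos_of_ne_zero (NeZero.ne L))).symm⟩
  funext b
  rw [Pi.mul_apply, axialBlockHolonomy_apply, axialBlockHolonomy_apply, List.range_succ_eq_map,
    List.map_cons, List.map_cons, List.prod_cons, List.prod_cons, List.map_map, List.map_map]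
  have htail : ((List.range L').map ((fun t => (firstLift (L' + 1) Λ h * U) (lineEdge (L' + 1) b t)) ∘ Nat.succ)) =
      (List.range L').map ((fun t => U (lineEdge (L' + 1) b t)) ∘ Nat.succ) := by
    refine List.map_congr_left fun t ht => ?_
    simp only [Function.comp_apply, Pi.mul_apply, Nat.succ_eq_add_one]
    rw [firstLift_lineEdge_succ _ _ _ _ (by have := List.mem_range.1 ht; omega), one_mul]
  rw [htail, Pi.mul_apply, ← mul_assoc]
  congr 1
  by_cases hb : b ∈ Λ
  · rw [firstLift_lineEdge_zero _ _ _ hb, glueWith_apply_mem _ _ _ hb]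
  · rw [glueWith_apply_not_mem _ _ _ hb, Pi.one_apply, one_mul, firstLift_apply, if_neg, one_mul]
    rintro ⟨-, h2⟩
    rw [coarseEdge_lineEdge _ b (Nat.succ_pos L')] at h2
    exact hb h2

end Lift


/-! ### Gluing algebra on `LGConfig d G` -/

section GlueAlgebra

variable [Group G]

/-- Gluing with boundary condition `1` is multiplicative. [folklore] -/
theorem glueWith_one_mul_distrib (Λ : Finset (ZdEdge d)) (y y' : ↥Λ → G) :
    glueWith Λ (y * y') (1 : LGConfig d G) = glueWith Λ y 1 * glueWith Λ y' 1 := by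
  funext e
  by_cases he : e ∈ Λ
  · simp [glueWith_apply_mem _ _ _ he]
  · simp [glueWith_apply_not_mem _ _ _ he]

/-- Gluing with boundary condition `1` commutes with inversion. [folklore] -/
theorem glueWith_one_inv (Λ : Finset (ZdEdge d)) (y : ↥Λ → G) :
    glueWith Λ y⁻¹ (1 : LGConfig d G) = (glueWith Λ y 1)⁻¹ := by
  funext e
  by_cases he : e ∈ Λ
  · simp [glueWith_apply_mem _ _ _ he]
  · simp [glueWith_apply_not_mem _ _ _ he]

/-- Re-gluing the restriction of a glued configuration gives it back. [folklore] -/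
theorem glueWith_restrict_glueWith (Λ : Finset (ZdEdge d)) (y : ↥Λ → G) :
    glueWith Λ (fun b : ↥Λ => glueWith Λ y (1 : LGConfig d G) b) (1 : LGConfig d G) =
      glueWith Λ y 1 := by
  funext e
  by_cases he : e ∈ Λ
  · simp [glueWith_apply_mem _ _ _ he]
  · simp [glueWith_apply_not_mem _ _ _ he]

/-- The block holonomy of a configuration glued on `fineEdges L Λ` is supported on `Λ`: it is the
gluing of its own restriction to `Λ`. [folklore] -/
theorem axialBlockHolonomy_glueWith_eq (L : ℕ) [NeZero L] (Λ : Finset (ZdEdge d))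
    (u : ↥(fineEdges L Λ) → G) :
    axialBlockHolonomy L (glueWith (fineEdges L Λ) u 1) =
      glueWith Λ (fun b : ↥Λ => axialBlockHolonomy L (glueWith (fineEdges L Λ) u 1) b) 1 := by
  conv_lhs => rw [axialBlockHolonomy_glueWith]
  conv_rhs => rw [axialBlockHolonomy_glueWith]
  rw [glueWith_restrict_glueWith]

/-- For a configuration `H` supported on `Λ` (`H = glueWith Λ (H|Λ) 1`), gluing the pointwise
inverses of `H|Λ` gives `H⁻¹`. [folklore] -/
theorem glueWith_inv_restrict (Λ : Finset (ZdEdge d)) {H : LGConfig d G}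
    (hH : H = glueWith Λ (fun b : ↥Λ => H b) 1) :
    glueWith Λ (fun b : ↥Λ => (H b)⁻¹) (1 : LGConfig d G) = H⁻¹ := by
  have : (fun b : ↥Λ => (H b)⁻¹) = (fun b : ↥Λ => H b)⁻¹ := rfl
  rw [this, glueWith_one_inv, ← hH]

end GlueAlgebra

/-! ### Measurability and Haar invariance -/

section Measurability

variable [Group G] [MeasurableSpace G]

/-- The block holonomy map is measurable (a finite ordered product of coordinates in each
component). [folklore] -/
theorem measurable_axialBlockHolonomy [MeasurableMul₂ G] (L : ℕ) :
    Measurable (axialBlockHolonomy (d := d) (G := G) L) := by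
  refine measurable_pi_lambda _ fun b => ?_
  have : (fun U : LGConfig d G => axialBlockHolonomy L U b) = fun U =>
      (((List.range L).map fun t => fun U : LGConfig d G => U (lineEdge L b t)).map
        fun f => f U).prod := by
    funext U
    rw [axialBlockHolonomy_apply, List.map_map]
    rfl
  rw [this]
  refine List.measurable_fun_prod _ fun f hf => ?_
  obtain ⟨t, -, rfl⟩ := List.mem_map.1 hf
  exact measurable_pi_apply _

/-- The first-link lift is measurable. [folklore] -/
theorem measurable_firstLift (L : ℕ) (Λ : Finset (ZdEdge d)) :
    Measurable (firstLift (d := d) (G := G) L Λ) := by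
  classical
  refine measurable_pi_lambda _ fun e => ?_
  by_cases hc : e = lineEdge L (coarseEdge L e) 0 ∧ coarseEdge L e ∈ Λ
  · simp only [firstLift_apply, if_pos hc]
    exact measurable_pi_apply _
  · simp only [firstLift_apply, if_neg hc]
    exact measurable_const

/-- Joint measurability of the integrand of the block RG step density `blockStepDensity`. [folklore] -/
theorem measurable_blockStepDensity_integrand [MeasurableMul₂ G] [MeasurableInv G] (L : ℕ)
    (Λ : Finset (ZdEdge d)) {w : LGConfig d G → ℝ≥0∞} (hw : Measurable w) :
    Measurable fun p : LGConfig d G × LGConfig d G =>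
      w (firstLift L Λ (p.1 * (axialBlockHolonomy L p.2)⁻¹) * p.2) :=
  hw.comp (((measurable_firstLift L Λ).comp
    (measurable_fst.mul ((measurable_axialBlockHolonomy L).comp measurable_snd).inv)).mul
      measurable_snd)

end Measurability

section Haar

variable [Group G] [MeasurableSpace G] [TopologicalSpace G] [IsTopologicalGroup G]
  [CompactSpace G] [BorelSpace G]

/-- `freeHaarConfig Λ` is a probability measure (local instance; cf.
`isProbabilityMeasure_freeHaarConfig` of `ConstructiveQFTBalabanRGProofs`). [folklore] -/
private instance instIsProbabilityMeasureFreeHaarConfig (Λ : Finset (ZdEdge d)) :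
    IsProbabilityMeasure (freeHaarConfig (G := G) Λ) :=
  Measure.isProbabilityMeasure_map (measurable_glueWith Λ (1 : LGConfig d G)).aemeasurable

/-- Right translations preserve the product Haar probability measure `Haar^{⊗Λ}` (compact groups
are unimodular; coordinatewise `measurePreserving_mul_mul_inv_haarProbability`). [folklore] -/
theorem measurePreserving_mul_right_pi (Λ : Finset (ZdEdge d)) (c : ↥Λ → G) :
    MeasurePreserving (fun y : ↥Λ → G => y * c)
      (Measure.pi fun _ : ↥Λ => QuantumFieldTheory.haarProbability G)
      (Measure.pi fun _ : ↥Λ => QuantumFieldTheory.haarProbability G) := by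
  have h := measurePreserving_pi (fun _ : ↥Λ => QuantumFieldTheory.haarProbability G)
    (fun _ : ↥Λ => QuantumFieldTheory.haarProbability G)
    (f := fun (b : ↥Λ) (x : G) => 1 * x * (c b)⁻¹⁻¹)
    fun b => measurePreserving_mul_mul_inv_haarProbability (1 : G) (c b)⁻¹
  have hfun : (fun (a : ↥Λ → G) (b : ↥Λ) => 1 * a b * (c b)⁻¹⁻¹) = fun y => y * c := by
    funext y b
    simp
  rwa [hfun] at h

/-- Left translations preserve the product Haar probability measure `Haar^{⊗Λ}`. [folklore] -/
theorem measurePreserving_mul_left_pi (Λ : Finset (ZdEdge d)) (c : ↥Λ → G) :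
    MeasurePreserving (fun y : ↥Λ → G => c * y)
      (Measure.pi fun _ : ↥Λ => QuantumFieldTheory.haarProbability G)
      (Measure.pi fun _ : ↥Λ => QuantumFieldTheory.haarProbability G) := by
  have h := measurePreserving_pi (fun _ : ↥Λ => QuantumFieldTheory.haarProbability G)
    (fun _ : ↥Λ => QuantumFieldTheory.haarProbability G)
    (f := fun (b : ↥Λ) (x : G) => c b * x * (1 : G)⁻¹)
    fun b => measurePreserving_mul_mul_inv_haarProbability (c b) (1 : G)
  have hfun : (fun (a : ↥Λ → G) (b : ↥Λ) => c b * a b * (1 : G)⁻¹) = fun y => c * y := by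
    funext y b
    simp
  rwa [hfun] at h

/-- **Haar invariance of the first-link change of variables**: left multiplication by the lift
`firstLift L Λ h` (supported on `fineEdges L Λ`) preserves the free-boundary reference measure
`freeHaarConfig (fineEdges L Λ)`. [folklore] -/
theorem measurePreserving_firstLift_mul (L : ℕ) [NeZero L] (Λ : Finset (ZdEdge d))
    (h : LGConfig d G) :
    MeasurePreserving (fun U : LGConfig d G => firstLift L Λ h * U)
      (freeHaarConfig (fineEdges L Λ)) (freeHaarConfig (fineEdges L Λ)) := by
  set Λ' := fineEdges L Λ
  have hT : Measurable fun U : LGConfig d G => firstLift L Λ h * U := measurable_const_mul _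
  refine ⟨hT, ?_⟩
  have hcomm : (fun U : LGConfig d G => firstLift L Λ h * U) ∘
      (fun u : ↥Λ' → G => glueWith Λ' u (1 : LGConfig d G)) =
      (fun u : ↥Λ' → G => glueWith Λ' u (1 : LGConfig d G)) ∘
        fun u : ↥Λ' → G => (fun e : ↥Λ' => firstLift L Λ h e) * u := by
    funext u e
    simp only [Function.comp_apply, Pi.mul_apply]
    by_cases he : e ∈ Λ'
    · rw [glueWith_apply_mem _ _ _ he, glueWith_apply_mem _ _ _ he, Pi.mul_apply]
    · rw [glueWith_apply_not_mem _ _ _ he, glueWith_apply_not_mem _ _ _ he, Pi.one_apply,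
        mul_one, firstLift_apply_of_not_mem L Λ h he]
  change Measure.map _ (Measure.map _ _) = _
  rw [Measure.map_map hT (measurable_glueWith _ _), hcomm,
    ← Measure.map_map (measurable_glueWith _ _) (measurable_const_mul _),
    (measurePreserving_mul_left_pi Λ' _).map_eq]
  rfl

end Haar


/-! ### One block RG step as an explicit integral: the pushforward formula -/

section Step

variable [Group G] [MeasurableSpace G] [TopologicalSpace G] [IsTopologicalGroup G]
  [CompactSpace G] [BorelSpace G]

/-- **The explicit block RG step density.** For a weight `w` on fine configurations, the
function `V ↦ ∫ w (firstLift L Λ (V · Ū⁻¹) · U) dU` on coarse configurations, where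
`Ū = axialBlockHolonomy L U` and `dU = freeHaarConfig (fineEdges L Λ)`: the fine field `U` is
modified on the first link of each block line over `Λ` so that its block holonomy becomes `V`
(on `Λ`), and the weight is averaged over `U`. By `map_axialBlockHolonomy_withDensity` this is a
density of the block RG transform of `w dU` with respect to `freeHaarConfig Λ` — an everywhere
defined version of Bałaban's `∫ ∏_b δ(V_b⁻¹ Ū_b) w(U) dU` (CMP 109 (1987) (0.1)–(0.2)) in the
free-boundary axial-gauge set-up of prelude A18. [folklore] -/
def blockStepDensity (L : ℕ) (Λ : Finset (ZdEdge d)) (w : LGConfig d G → ℝ≥0∞) (V : LGConfig d G) :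
    ℝ≥0∞ :=
  ∫⁻ U, w (firstLift L Λ (V * (axialBlockHolonomy L U)⁻¹) * U) ∂freeHaarConfig (fineEdges L Λ)

/-- The step density reads the coarse field only on `Λ`. [folklore] -/
theorem blockStepDensity_congr (L : ℕ) (Λ : Finset (ZdEdge d)) (w : LGConfig d G → ℝ≥0∞)
    {V V' : LGConfig d G} (h : ∀ b ∈ Λ, V b = V' b) :
    blockStepDensity L Λ w V = blockStepDensity L Λ w V' := by
  unfold blockStepDensity
  refine lintegral_congr fun U => ?_
  rw [firstLift_congr L Λ (h' := V' * (axialBlockHolonomy L U)⁻¹)]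
  intro b hb
  simp [h b hb]

variable [MeasurableMul₂ G]

/-- The step density is measurable (Tonelli). [folklore] -/
theorem measurable_blockStepDensity (L : ℕ) (Λ : Finset (ZdEdge d)) {w : LGConfig d G → ℝ≥0∞}
    (hw : Measurable w) : Measurable (blockStepDensity L Λ w) :=
  (measurable_blockStepDensity_integrand L Λ hw).lintegral_prod_right'


/-- **Pushforward formula for one block RG step** (free boundary condition, axial gauge): for
every measurable weight `w` on fine configurations, the image of `w · freeHaarConfig (fineEdges L Λ)`
under the block holonomy map `axialBlockHolonomy L` (`L ≥ 1`) is
`blockStepDensity L Λ w · freeHaarConfig Λ`. Proof: Haar invariance of `freeHaarConfig (fineEdges L Λ)`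
under left multiplication by first-link lifts (`measurePreserving_firstLift_mul`), under which
the block holonomy is left-translated (`axialBlockHolonomy_firstLift_mul`); averaging over the
translation with respect to `Haar^{⊗Λ}`, Tonelli, and right invariance of `Haar^{⊗Λ}`
(`measurePreserving_mul_right_pi`) to recentre the translation at `Ū⁻¹`. This is the rigorous
form of `ρ_{k+1}(V) = ∫ ∏_{b ∈ Λ} δ(V_b⁻¹ Ū_b) ρ_k(U) dU` (Bałaban CMP 109 (1987) (0.1)–(0.2);
prelude A18 `IsBlockRGStepOf`). [folklore] -/
theorem map_axialBlockHolonomy_withDensity (L : ℕ) [NeZero L] (Λ : Finset (ZdEdge d))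
    {w : LGConfig d G → ℝ≥0∞} (hw : Measurable w) :
    ((freeHaarConfig (fineEdges L Λ)).withDensity w).map (axialBlockHolonomy L) =
      (freeHaarConfig Λ).withDensity (blockStepDensity L Λ w) := by
  classical
  have hhol : Measurable (axialBlockHolonomy (d := d) (G := G) L) := measurable_axialBlockHolonomy L
  have hlift : Measurable (firstLift (d := d) (G := G) L Λ) := measurable_firstLift L Λ
  have hgl : Measurable fun y : ↥Λ → G => glueWith Λ y (1 : LGConfig d G) := measurable_glueWith _ _
  have hgl' : Measurable fun u : ↥(fineEdges L Λ) → G => glueWith (fineEdges L Λ) u (1 : LGConfig d G) :=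
    measurable_glueWith _ _
  set μ' : Measure (LGConfig d G) := freeHaarConfig (fineEdges L Λ) with hμ'_def
  set μ : Measure (LGConfig d G) := freeHaarConfig Λ with hμ_def
  set πΛ : Measure (↥Λ → G) := Measure.pi fun _ => QuantumFieldTheory.haarProbability G
    with hπΛ_def
  set π' : Measure (↥(fineEdges L Λ) → G) := Measure.pi fun _ => QuantumFieldTheory.haarProbability G
    with hπ'_def
  have hμ : μ = πΛ.map fun y : ↥Λ → G => glueWith Λ y (1 : LGConfig d G) := rfl
  have hμ' : μ' = π'.map fun u : ↥(fineEdges L Λ) → G =>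
      glueWith (fineEdges L Λ) u (1 : LGConfig d G) := rfl
  ext A hA
  rw [Measure.map_apply hhol hA, withDensity_apply _ (hhol hA), withDensity_apply _ hA,
    ← lintegral_indicator (hhol hA), ← lintegral_indicator hA]
  have hF₀ : Measurable ((axialBlockHolonomy L ⁻¹' A).indicator w) := hw.indicator (hhol hA)
  -- Steps 1–2: invariance under first-link lifts, averaged over the lift.
  have h12 : ∫⁻ U, (axialBlockHolonomy L ⁻¹' A).indicator w U ∂μ' =
      ∫⁻ y, ∫⁻ U, (axialBlockHolonomy L ⁻¹' A).indicator w
        (firstLift L Λ (glueWith Λ y 1) * U) ∂μ' ∂πΛ := by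
    have : (fun y : ↥Λ → G => ∫⁻ U, (axialBlockHolonomy L ⁻¹' A).indicator w
        (firstLift L Λ (glueWith Λ y 1) * U) ∂μ') =
        fun _ => ∫⁻ U, (axialBlockHolonomy L ⁻¹' A).indicator w U ∂μ' :=
      funext fun y => (measurePreserving_firstLift_mul L Λ (glueWith Λ y 1)).lintegral_comp hF₀
    rw [this, lintegral_const, measure_univ, mul_one]
  -- Step 3: the fine integral as an integral over `G^{fineEdges L Λ}`.
  have h3 : (fun y : ↥Λ → G => ∫⁻ U, (axialBlockHolonomy L ⁻¹' A).indicator w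
        (firstLift L Λ (glueWith Λ y 1) * U) ∂μ') =
      fun y => ∫⁻ u, (axialBlockHolonomy L ⁻¹' A).indicator w
        (firstLift L Λ (glueWith Λ y 1) * glueWith (fineEdges L Λ) u 1) ∂π' := by
    funext y
    have hm : Measurable fun U : LGConfig d G => (axialBlockHolonomy L ⁻¹' A).indicator w
        (firstLift L Λ (glueWith Λ y 1) * U) := hF₀.comp (measurable_const_mul _)
    rw [hμ', lintegral_map hm hgl']
  -- Joint measurability of the two integrands.
  have hΨ : Measurable fun p : (↥Λ → G) × (↥(fineEdges L Λ) → G) =>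
      (axialBlockHolonomy L ⁻¹' A).indicator w
        (firstLift L Λ (glueWith Λ p.1 1) * glueWith (fineEdges L Λ) p.2 1) :=
    hF₀.comp ((hlift.comp (hgl.comp measurable_fst)).mul (hgl'.comp measurable_snd))
  have hΨ₂ : Measurable fun p : (↥Λ → G) × (↥(fineEdges L Λ) → G) =>
      A.indicator (fun _ => (1 : ℝ≥0∞)) (glueWith Λ p.1 1) *
        w (firstLift L Λ (glueWith Λ p.1 1) *
          firstLift L Λ (axialBlockHolonomy L (glueWith (fineEdges L Λ) p.2 1))⁻¹ *
            glueWith (fineEdges L Λ) p.2 1) :=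
    ((measurable_const.indicator hA).comp (hgl.comp measurable_fst)).mul
      (hw.comp (((hlift.comp (hgl.comp measurable_fst)).mul
        (hlift.comp ((hhol.comp (hgl'.comp measurable_snd)).inv))).mul (hgl'.comp measurable_snd)))
  -- Step 5: recentring the translation (right invariance of `Haar^{⊗Λ}`), pointwise in `u`.
  have h5 : ∀ u : ↥(fineEdges L Λ) → G,
      ∫⁻ y, (axialBlockHolonomy L ⁻¹' A).indicator w
        (firstLift L Λ (glueWith Λ y 1) * glueWith (fineEdges L Λ) u 1) ∂πΛ =
      ∫⁻ y, A.indicator (fun _ => (1 : ℝ≥0∞)) (glueWith Λ y 1) *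
        w (firstLift L Λ (glueWith Λ y 1) *
          firstLift L Λ (axialBlockHolonomy L (glueWith (fineEdges L Λ) u 1))⁻¹ *
            glueWith (fineEdges L Λ) u 1) ∂πΛ := by
    intro u
    have hHsupp := axialBlockHolonomy_glueWith_eq (G := G) L Λ u
    obtain ⟨c, hc⟩ : ∃ c : ↥Λ → G,
        c = fun b : ↥Λ => (axialBlockHolonomy L (glueWith (fineEdges L Λ) u 1) b)⁻¹ := ⟨_, rfl⟩
    have hglc : glueWith Λ c (1 : LGConfig d G) =
        (axialBlockHolonomy L (glueWith (fineEdges L Λ) u 1))⁻¹ := by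
      rw [hc]
      exact glueWith_inv_restrict Λ hHsupp
    have hmeas : Measurable fun y : ↥Λ → G => (axialBlockHolonomy L ⁻¹' A).indicator w
        (firstLift L Λ (glueWith Λ y 1) * glueWith (fineEdges L Λ) u 1) :=
      hF₀.comp ((hlift.comp hgl).mul_const _)
    have hsub := (measurePreserving_mul_right_pi Λ c).lintegral_comp hmeas
    rw [← hsub]
    refine lintegral_congr fun y => ?_
    have hgl_mul : glueWith Λ (y * c) (1 : LGConfig d G) =
        glueWith Λ y 1 * (axialBlockHolonomy L (glueWith (fineEdges L Λ) u 1))⁻¹ := by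
      rw [← hglc]
      exact glueWith_one_mul_distrib Λ y c
    have hlift_mul : firstLift L Λ (glueWith Λ (y * c) 1) =
        firstLift L Λ (glueWith Λ y 1) *
          firstLift L Λ (axialBlockHolonomy L (glueWith (fineEdges L Λ) u 1))⁻¹ := by
      rw [hgl_mul]
      exact firstLift_mul L Λ _ _
    have hhol_eq : axialBlockHolonomy L (firstLift L Λ (glueWith Λ (y * c) 1) *
        glueWith (fineEdges L Λ) u 1) = glueWith Λ y 1 := by
      rw [axialBlockHolonomy_firstLift_mul, glueWith_restrict_glueWith, hgl_mul,
        inv_mul_cancel_right]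
    rw [Set.indicator_apply, Set.indicator_apply, Set.mem_preimage, hhol_eq, hlift_mul]
    by_cases hy : glueWith Λ y (1 : LGConfig d G) ∈ A
    · rw [if_pos hy, if_pos hy, one_mul]
    · rw [if_neg hy, if_neg hy, zero_mul]
  -- Step 6: the inner fine integral is the step density.
  have h6 : ∀ y : ↥Λ → G,
      ∫⁻ u, A.indicator (fun _ => (1 : ℝ≥0∞)) (glueWith Λ y 1) *
        w (firstLift L Λ (glueWith Λ y 1) *
          firstLift L Λ (axialBlockHolonomy L (glueWith (fineEdges L Λ) u 1))⁻¹ *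
            glueWith (fineEdges L Λ) u 1) ∂π' =
      A.indicator (blockStepDensity L Λ w) (glueWith Λ y 1) := by
    intro y
    have hmeas : Measurable fun U : LGConfig d G =>
        w (firstLift L Λ (glueWith Λ y 1) * firstLift L Λ (axialBlockHolonomy L U)⁻¹ * U) :=
      hw.comp (((measurable_const).mul (hlift.comp hhol.inv)).mul measurable_id)
    have hm2 : Measurable fun u : ↥(fineEdges L Λ) → G => w (firstLift L Λ (glueWith Λ y 1) *
        firstLift L Λ (axialBlockHolonomy L (glueWith (fineEdges L Λ) u 1))⁻¹ *
          glueWith (fineEdges L Λ) u 1) := hmeas.comp hgl'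
    rw [lintegral_const_mul _ hm2, ← lintegral_map hmeas hgl', ← hμ']
    have hD : blockStepDensity L Λ w (glueWith Λ y 1) = ∫⁻ U,
        w (firstLift L Λ (glueWith Λ y 1) * firstLift L Λ (axialBlockHolonomy L U)⁻¹ * U) ∂μ' := by
      unfold blockStepDensity
      refine lintegral_congr fun U => ?_
      rw [firstLift_mul]
    rw [← hD, Set.indicator_apply, Set.indicator_apply]
    by_cases hy : glueWith Λ y (1 : LGConfig d G) ∈ A
    · rw [if_pos hy, if_pos hy, one_mul]
    · rw [if_neg hy, if_neg hy, zero_mul]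
  -- Assemble.
  rw [h12, h3, lintegral_lintegral_swap hΨ.aemeasurable]
  simp_rw [h5]
  have hΨ₂' : Measurable fun p : (↥(fineEdges L Λ) → G) × (↥Λ → G) =>
      A.indicator (fun _ => (1 : ℝ≥0∞)) (glueWith Λ p.2 1) *
        w (firstLift L Λ (glueWith Λ p.2 1) *
          firstLift L Λ (axialBlockHolonomy L (glueWith (fineEdges L Λ) p.1 1))⁻¹ *
            glueWith (fineEdges L Λ) p.1 1) := hΨ₂.comp measurable_swap
  rw [lintegral_lintegral_swap hΨ₂'.aemeasurable]
  simp_rw [h6]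
  rw [hμ, lintegral_map ((measurable_blockStepDensity L Λ hw).indicator hA) hgl]

/-- Total mass is preserved by the block RG step: `∫ blockStepDensity w dV = ∫ w dU`. [folklore] -/
theorem lintegral_blockStepDensity (L : ℕ) [NeZero L] (Λ : Finset (ZdEdge d))
    {w : LGConfig d G → ℝ≥0∞} (hw : Measurable w) :
    ∫⁻ V, blockStepDensity L Λ w V ∂freeHaarConfig Λ = ∫⁻ U, w U ∂freeHaarConfig (fineEdges L Λ) := by
  have h := congrArg (fun ν : Measure (LGConfig d G) => ν Set.univ)
    (map_axialBlockHolonomy_withDensity L Λ hw)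
  simp only [Measure.map_apply (measurable_axialBlockHolonomy L) MeasurableSet.univ,
    Set.preimage_univ, withDensity_apply _ MeasurableSet.univ, Measure.restrict_univ] at h
  exact h.symm

end Step


/-! ### Propagation of bounds and of the oscillation estimate through one step -/

section StepBounds

variable [Group G] [MeasurableSpace G] [TopologicalSpace G] [IsTopologicalGroup G]
  [CompactSpace G] [BorelSpace G]

/-- A uniform lower bound of the weight passes to the step density. [folklore] -/
theorem le_blockStepDensity (L : ℕ) (Λ : Finset (ZdEdge d)) {w : LGConfig d G → ℝ≥0∞} {m : ℝ≥0∞}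
    (hm : ∀ U, m ≤ w U) (V : LGConfig d G) : m ≤ blockStepDensity L Λ w V := by
  unfold blockStepDensity
  calc m = ∫⁻ _, m ∂freeHaarConfig (G := G) (fineEdges L Λ) := by
        rw [lintegral_const, measure_univ, mul_one]
    _ ≤ _ := lintegral_mono fun U => hm _

/-- A uniform upper bound of the weight passes to the step density. [folklore] -/
theorem blockStepDensity_le (L : ℕ) (Λ : Finset (ZdEdge d)) {w : LGConfig d G → ℝ≥0∞} {B : ℝ≥0∞}
    (hB : ∀ U, w U ≤ B) (V : LGConfig d G) : blockStepDensity L Λ w V ≤ B := by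
  unfold blockStepDensity
  calc _ ≤ ∫⁻ _, B ∂freeHaarConfig (G := G) (fineEdges L Λ) := lintegral_mono fun U => hB _
    _ = B := by rw [lintegral_const, measure_univ, mul_one]

omit [MeasurableSpace G] [TopologicalSpace G] [IsTopologicalGroup G] [CompactSpace G]
  [BorelSpace G] in
/-- If two coarse fields agree off `F`, the corresponding first-link modifications of a fine
field agree off the first edges of the lines over `F`. [folklore] -/
theorem firstLift_mul_apply_eq_of_not_mem (L : ℕ) (Λ : Finset (ZdEdge d)) (F : Finset (ZdEdge d))
    {V V' : LGConfig d G} (hV : ∀ e ∉ F, V e = V' e) (H U : LGConfig d G) {e : ZdEdge d}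
    (he : e ∉ F.image fun b => lineEdge L b 0) :
    (firstLift L Λ (V * H) * U) e = (firstLift L Λ (V' * H) * U) e := by
  classical
  simp only [Pi.mul_apply, firstLift_apply]
  split_ifs with hc
  · have hb : coarseEdge L e ∉ F := fun hF => he (Finset.mem_image.2 ⟨_, hF, hc.1.symm⟩)
    rw [hV _ hb]
  · rfl

/-- **The oscillation estimate passes through the block RG step with the same constant**: if
changing the fine field on a finite edge set `F` changes the weight by at most a factor
`e^{K|F|}`, the same holds for the step density as a function of the coarse field (changing the
coarse field on `F` moves only the first links of the lines over `F`). [folklore] -/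
theorem blockStepDensity_osc (L : ℕ) (Λ : Finset (ZdEdge d)) {w : LGConfig d G → ℝ≥0∞} {K : ℝ}
    (hK : 0 ≤ K)
    (hw : ∀ (F : Finset (ZdEdge d)) (U U' : LGConfig d G), (∀ e ∉ F, U e = U' e) →
      w U ≤ ENNReal.ofReal (Real.exp (K * F.card)) * w U')
    (F : Finset (ZdEdge d)) {V V' : LGConfig d G} (hV : ∀ e ∉ F, V e = V' e) :
    blockStepDensity L Λ w V ≤ ENNReal.ofReal (Real.exp (K * F.card)) * blockStepDensity L Λ w V' := by
  classical
  unfold blockStepDensity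
  rw [← lintegral_const_mul' _ _ ENNReal.ofReal_ne_top]
  refine lintegral_mono fun U => ?_
  have h1 := hw (F.image fun b => lineEdge L b 0)
    (firstLift L Λ (V * (axialBlockHolonomy L U)⁻¹) * U)
    (firstLift L Λ (V' * (axialBlockHolonomy L U)⁻¹) * U)
    (fun e he => firstLift_mul_apply_eq_of_not_mem L Λ F hV _ U he)
  refine h1.trans ?_
  have hcard : ((F.image fun b => lineEdge L b 0).card : ℝ) ≤ F.card := by
    exact_mod_cast Finset.card_image_le
  gcongr

/-- A step density that only reads `Λ`, oscillates by at most `e^{K|F|}` under changes on `F`,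
and has total mass `1` for the probability measure `freeHaarConfig Λ`, is pinched:
`e^{-K|Λ|} ≤ D(V) ≤ e^{K|Λ|}` for **every** coarse field `V`. [folklore] -/
theorem bounds_of_osc_of_lintegral_eq_one {D : LGConfig d G → ℝ≥0∞} (Λ : Finset (ZdEdge d)) {K : ℝ}
    (hD : Measurable D)
    (hread : ∀ V V' : LGConfig d G, (∀ b ∈ Λ, V b = V' b) → D V = D V')
    (hosc : ∀ (F : Finset (ZdEdge d)) (V V' : LGConfig d G), (∀ e ∉ F, V e = V' e) →
      D V ≤ ENNReal.ofReal (Real.exp (K * F.card)) * D V')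
    (hmass : ∫⁻ V, D V ∂freeHaarConfig Λ = 1) (V : LGConfig d G) :
    ENNReal.ofReal (Real.exp (-(K * Λ.card))) ≤ D V ∧
      D V ≤ ENNReal.ofReal (Real.exp (K * Λ.card)) := by
  classical
  -- any two coarse fields compare by the factor `e^{K|Λ|}`
  have hcmp : ∀ V V' : LGConfig d G, D V ≤ ENNReal.ofReal (Real.exp (K * Λ.card)) * D V' := by
    intro V V'
    rw [hread V (glueWith Λ (fun b : ↥Λ => V b) 1) fun b hb => by rw [glueWith_apply_mem _ _ _ hb],
      hread V' (glueWith Λ (fun b : ↥Λ => V' b) 1) fun b hb => by rw [glueWith_apply_mem _ _ _ hb]]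
    refine hosc Λ _ _ fun e he => ?_
    rw [glueWith_apply_not_mem _ _ _ he, glueWith_apply_not_mem _ _ _ he]
  have hA : ENNReal.ofReal (Real.exp (K * Λ.card)) ≠ 0 :=
    (ENNReal.ofReal_pos.2 (Real.exp_pos _)).ne'
  constructor
  · -- integrate `hcmp V' V` over `V'`
    have h1 : (1 : ℝ≥0∞) ≤ ENNReal.ofReal (Real.exp (K * Λ.card)) * D V := by
      calc (1 : ℝ≥0∞) = ∫⁻ V', D V' ∂freeHaarConfig Λ := hmass.symm
        _ ≤ ∫⁻ _, ENNReal.ofReal (Real.exp (K * Λ.card)) * D V ∂freeHaarConfig (G := G) Λ :=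
          lintegral_mono fun V' => hcmp V' V
        _ = _ := by rw [lintegral_const, measure_univ, mul_one]
    rw [Real.exp_neg, ENNReal.ofReal_inv_of_pos (Real.exp_pos _)]
    exact (ENNReal.inv_le_iff_le_mul (fun _ => hA)
      (fun h => absurd h ENNReal.ofReal_ne_top)).2 h1
  · calc D V = ∫⁻ _, D V ∂freeHaarConfig (G := G) Λ := by
          rw [lintegral_const, measure_univ, mul_one]
      _ ≤ ∫⁻ V', ENNReal.ofReal (Real.exp (K * Λ.card)) * D V' ∂freeHaarConfig Λ :=
          lintegral_mono fun V' => hcmp V V'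
      _ = ENNReal.ofReal (Real.exp (K * Λ.card)) * ∫⁻ V', D V' ∂freeHaarConfig Λ := by
          rw [lintegral_const_mul _ hD]
      _ = _ := by rw [hmass, mul_one]

end StepBounds

/-! ### The Wilson weight: boundedness and oscillation via plaquette counting -/

section Wilson

variable [Group G]

/-- The number of unordered coordinate planes `{(i, j) : i < j}` times `1 + d`: at most this
many plaquettes contain a given edge's worth of base points (crude count from the explicit
construction of `plaquettesTouching`). [folklore] -/
theorem card_plaquettesTouching_le (F : Finset (ZdEdge d)) :
    (plaquettesTouching F).card ≤
      (1 + d) * Fintype.card {p : Fin d × Fin d // p.1 < p.2} * F.card := by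
  classical
  unfold plaquettesTouching
  refine (Finset.card_filter_le _ _).trans ?_
  rw [Finset.card_product, Finset.card_univ]
  have ha := Finset.card_image_le (s := F) (f := Prod.fst)
  have hb := Finset.card_image_le (s := F ×ˢ (Finset.univ : Finset (Fin d)))
    (f := fun ej : ZdEdge d × Fin d => ej.1.1 - Pi.single ej.2 (1 : ℤ))
  rw [Finset.card_product, Finset.card_univ, Fintype.card_fin] at hb
  have hu := Finset.card_union_le (F.image Prod.fst)
    ((F ×ˢ (Finset.univ : Finset (Fin d))).image
      fun ej : ZdEdge d × Fin d => ej.1.1 - Pi.single ej.2 (1 : ℤ))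
  have h1 : (F.image Prod.fst ∪ (F ×ˢ (Finset.univ : Finset (Fin d))).image
      fun ej : ZdEdge d × Fin d => ej.1.1 - Pi.single ej.2 (1 : ℤ)).card ≤ (1 + d) * F.card := by
    calc _ ≤ F.card + F.card * d := hu.trans (Nat.add_le_add ha hb)
      _ = (1 + d) * F.card := by ring
  calc _ ≤ (1 + d) * F.card * Fintype.card {p : Fin d × Fin d // p.1 < p.2} :=
        Nat.mul_le_mul_right _ h1
    _ = _ := by ring

variable (ρ : G →* Matrix (Fin N) (Fin N) ℂ)

/-- A plaquette not touching `F` has the same observable on configurations agreeing off `F`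
(locality `isCylinder_plaquetteObs`). [folklore] -/
theorem plaquetteObs_eq_of_not_mem_plaquettesTouching (p : ZdPlaquette d) {F : Finset (ZdEdge d)}
    {U U' : LGConfig d G} (hU : ∀ e ∉ F, U e = U' e) (hp : p ∉ plaquettesTouching F) :
    plaquetteObs ρ p.1 p.2.1.1 p.2.1.2 U = plaquetteObs ρ p.1 p.2.1.1 p.2.1.2 U' :=
  isCylinder_plaquetteObs ρ p fun e he => hU e fun heF =>
    hp (mem_plaquettesTouching_iff.2 ⟨e, Finset.mem_inter.2 ⟨Finset.mem_coe.1 he, heF⟩⟩)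

/-- **Oscillation of the boundary Wilson action**: if `|Re tr ρ(U_p)| ≤ C` uniformly, changing
the configuration on a finite edge set `F` changes `S_Λ` by at most `2C · #plaquettesTouching F`,
uniformly in the volume `Λ` (only plaquettes touching `F` contribute). [folklore] -/
theorem abs_wilsonBoundaryAction_sub_le {C : ℝ} (hC0 : 0 ≤ C)
    (hC : ∀ (x : Site d) (i j : Fin d) (U : LGConfig d G), |plaquetteObs ρ x i j U| ≤ C)
    (Λ F : Finset (ZdEdge d)) {U U' : LGConfig d G} (hU : ∀ e ∉ F, U e = U' e) :
    |wilsonBoundaryAction ρ Λ U - wilsonBoundaryAction ρ Λ U'| ≤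
      2 * C * (plaquettesTouching F).card := by
  classical
  unfold wilsonBoundaryAction
  rw [← Finset.sum_sub_distrib]
  have key : ∑ p ∈ plaquettesTouching Λ,
      (((N : ℝ) - plaquetteObs ρ p.1 p.2.1.1 p.2.1.2 U) -
        ((N : ℝ) - plaquetteObs ρ p.1 p.2.1.1 p.2.1.2 U')) =
      ∑ p ∈ plaquettesTouching Λ with p ∈ plaquettesTouching F,
        (plaquetteObs ρ p.1 p.2.1.1 p.2.1.2 U' - plaquetteObs ρ p.1 p.2.1.1 p.2.1.2 U) := by
    rw [Finset.sum_filter]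
    refine Finset.sum_congr rfl fun p _ => ?_
    split_ifs with hpS
    · ring
    · rw [plaquetteObs_eq_of_not_mem_plaquettesTouching ρ p hU hpS]
      ring
  rw [key]
  refine (Finset.abs_sum_le_sum_abs _ _).trans ?_
  refine (Finset.sum_le_card_nsmul _ _ (2 * C) fun p _ => ?_).trans ?_
  · have h1 := hC p.1 p.2.1.1 p.2.1.2 U'
    have h2 := hC p.1 p.2.1.1 p.2.1.2 U
    rw [abs_le] at h1 h2 ⊢
    constructor <;> linarith
  · rw [nsmul_eq_mul]
    have hsub : ({p ∈ plaquettesTouching Λ | p ∈ plaquettesTouching F} : Finset _).card ≤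
        (plaquettesTouching F).card :=
      Finset.card_le_card fun p hp => (Finset.mem_filter.1 hp).2
    have : (({p ∈ plaquettesTouching Λ | p ∈ plaquettesTouching F} : Finset _).card : ℝ) ≤
        (plaquettesTouching F).card := by exact_mod_cast hsub
    nlinarith

/-- **Boundedness of the boundary Wilson action**: `|S_Λ(U)| ≤ (N + C) · #plaquettesTouching Λ`. [folklore] -/
theorem abs_wilsonBoundaryAction_le {C : ℝ}
    (hC : ∀ (x : Site d) (i j : Fin d) (U : LGConfig d G), |plaquetteObs ρ x i j U| ≤ C)
    (Λ : Finset (ZdEdge d)) (U : LGConfig d G) :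
    |wilsonBoundaryAction ρ Λ U| ≤ (N + C) * (plaquettesTouching Λ).card := by
  unfold wilsonBoundaryAction
  refine (Finset.abs_sum_le_sum_abs _ _).trans ?_
  refine (Finset.sum_le_card_nsmul _ _ ((N : ℝ) + C) fun p _ => ?_).trans ?_
  · have h1 := hC p.1 p.2.1.1 p.2.1.2 U
    rw [abs_le] at h1 ⊢
    have hN : (0 : ℝ) ≤ N := Nat.cast_nonneg N
    constructor <;> linarith
  · rw [nsmul_eq_mul, mul_comm]

end Wilson


/-! ### Normalised Haar iterates of a weight family -/

section Iterate

variable [Group G] [MeasurableSpace G] [TopologicalSpace G] [IsTopologicalGroup G]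
  [CompactSpace G] [BorelSpace G]

/-- **Normalised block RG iterates** of a family of weights `w₀ Λ` (one weight per finite edge
volume): `ρ_0(Λ, ·) = w₀ Λ` and
`ρ_{k+1}(Λ, ·) = blockStepDensity M Λ ρ_k(fineEdges M Λ, ·) / ∫ ρ_k(fineEdges M Λ, U) dU`, i.e. the
explicit block RG transform (`map_axialBlockHolonomy_withDensity`) of the previous iterate on the
finer volume, normalised to total mass one (the normalising constant is the free-energy
normalisation `e^{-E_k(Λ)}` of `BlockRGScheme.IsRGIterateWith`). Values in `ℝ≥0∞`. [folklore] -/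
def rgIterate (M : ℕ) (w₀ : Finset (ZdEdge d) → LGConfig d G → ℝ≥0∞) :
    ℕ → Finset (ZdEdge d) → LGConfig d G → ℝ≥0∞
  | 0 => w₀
  | k + 1 => fun Λ V =>
      blockStepDensity M Λ (rgIterate M w₀ k (fineEdges M Λ)) V /
        ∫⁻ U, rgIterate M w₀ k (fineEdges M Λ) U ∂freeHaarConfig (fineEdges M Λ)

/-- The zeroth iterate is the starting weight. [folklore] -/
@[simp] theorem rgIterate_zero (M : ℕ) (w₀ : Finset (ZdEdge d) → LGConfig d G → ℝ≥0∞) :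
    rgIterate M w₀ 0 = w₀ := rfl

/-- The successor iterate is the normalised block RG transform of the previous one on the finer
volume. [folklore] -/
theorem rgIterate_succ (M : ℕ) (w₀ : Finset (ZdEdge d) → LGConfig d G → ℝ≥0∞) (k : ℕ)
    (Λ : Finset (ZdEdge d)) (V : LGConfig d G) :
    rgIterate M w₀ (k + 1) Λ V =
      blockStepDensity M Λ (rgIterate M w₀ k (fineEdges M Λ)) V /
        ∫⁻ U, rgIterate M w₀ k (fineEdges M Λ) U ∂freeHaarConfig (fineEdges M Λ) := rfl

/-- The iterates from step `1` on only read the coarse field on their volume. [folklore] -/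
theorem rgIterate_succ_congr (M : ℕ) (w₀ : Finset (ZdEdge d) → LGConfig d G → ℝ≥0∞) (k : ℕ)
    (Λ : Finset (ZdEdge d)) {V V' : LGConfig d G} (h : ∀ b ∈ Λ, V b = V' b) :
    rgIterate M w₀ (k + 1) Λ V = rgIterate M w₀ (k + 1) Λ V' := by
  rw [rgIterate_succ, rgIterate_succ, blockStepDensity_congr M Λ _ h]

variable [MeasurableMul₂ G]

/-- **Invariants of the normalised iterates** (induction on `k`): measurability, a positive
uniform lower bound, a finite uniform upper bound, and the oscillation estimate with the *same*
constant `K` at every scale — the elementary single-scheme UV stability mechanism (review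
r02500B): Haar invariance bounds the log-oscillation of every iterate by that of the starting
weight. [folklore] -/
theorem rgIterate_spec (M : ℕ) {w₀ : Finset (ZdEdge d) → LGConfig d G → ℝ≥0∞} {K : ℝ} (hK : 0 ≤ K)
    (hmeas : ∀ Λ, Measurable (w₀ Λ))
    (hpos : ∀ Λ, ∃ m : ℝ≥0∞, m ≠ 0 ∧ ∀ U, m ≤ w₀ Λ U)
    (hbdd : ∀ Λ, ∃ B : ℝ≥0∞, B ≠ ∞ ∧ ∀ U, w₀ Λ U ≤ B)
    (hosc : ∀ (Λ F : Finset (ZdEdge d)) (U U' : LGConfig d G), (∀ e ∉ F, U e = U' e) →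
      w₀ Λ U ≤ ENNReal.ofReal (Real.exp (K * F.card)) * w₀ Λ U')
    (k : ℕ) (Λ : Finset (ZdEdge d)) :
    Measurable (rgIterate M w₀ k Λ) ∧
      (∃ m : ℝ≥0∞, m ≠ 0 ∧ ∀ U, m ≤ rgIterate M w₀ k Λ U) ∧
      (∃ B : ℝ≥0∞, B ≠ ∞ ∧ ∀ U, rgIterate M w₀ k Λ U ≤ B) ∧
      (∀ (F : Finset (ZdEdge d)) (U U' : LGConfig d G), (∀ e ∉ F, U e = U' e) →
        rgIterate M w₀ k Λ U ≤ ENNReal.ofReal (Real.exp (K * F.card)) * rgIterate M w₀ k Λ U') := by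
  induction k generalizing Λ with
  | zero => exact ⟨hmeas Λ, hpos Λ, hbdd Λ, hosc Λ⟩
  | succ k ih =>
    obtain ⟨hm, ⟨m, hm0, hml⟩, ⟨B, hBt, hBu⟩, ho⟩ := ih (fineEdges M Λ)
    set w := rgIterate M w₀ k (fineEdges M Λ) with hw_def
    set Z := ∫⁻ U, w U ∂freeHaarConfig (fineEdges M Λ) with hZ_def
    have hmZ : m ≤ Z := by
      calc m = ∫⁻ _, m ∂freeHaarConfig (G := G) (fineEdges M Λ) := by
            rw [lintegral_const, measure_univ, mul_one]
        _ ≤ Z := lintegral_mono fun U => hml U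
    have hZB : Z ≤ B := by
      calc Z ≤ ∫⁻ _, B ∂freeHaarConfig (G := G) (fineEdges M Λ) := lintegral_mono fun U => hBu U
        _ = B := by rw [lintegral_const, measure_univ, mul_one]
    have hZ0 : Z ≠ 0 := fun h => hm0 (le_zero_iff.1 (h ▸ hmZ))
    have hZt : Z ≠ ∞ := ne_top_of_le_ne_top hBt hZB
    have hsucc : ∀ V, rgIterate M w₀ (k + 1) Λ V = blockStepDensity M Λ w V / Z := fun V => rfl
    refine ⟨?_, ⟨m / Z, (ENNReal.div_pos_iff.2 ⟨hm0, hZt⟩).ne', fun U => ?_⟩,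
      ⟨B / Z, (ENNReal.div_lt_top hBt hZ0).ne, fun U => ?_⟩, fun F U U' hU => ?_⟩
    · have : rgIterate M w₀ (k + 1) Λ = fun V => blockStepDensity M Λ w V / Z := funext hsucc
      rw [this]
      exact (measurable_blockStepDensity M Λ hm).div_const _
    · rw [hsucc]
      exact ENNReal.div_le_div_right (le_blockStepDensity M Λ hml U) Z
    · rw [hsucc]
      exact ENNReal.div_le_div_right (blockStepDensity_le M Λ hBu U) Z
    · rw [hsucc, hsucc, ← mul_div_assoc]
      exact ENNReal.div_le_div_right (blockStepDensity_osc M Λ hK ho F hU) Z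

/-- The normalising constant of the `(k+1)`-st iterate is positive and finite. [folklore] -/
theorem rgIterate_normaliser_ne (M : ℕ) {w₀ : Finset (ZdEdge d) → LGConfig d G → ℝ≥0∞} {K : ℝ}
    (hK : 0 ≤ K) (hmeas : ∀ Λ, Measurable (w₀ Λ))
    (hpos : ∀ Λ, ∃ m : ℝ≥0∞, m ≠ 0 ∧ ∀ U, m ≤ w₀ Λ U)
    (hbdd : ∀ Λ, ∃ B : ℝ≥0∞, B ≠ ∞ ∧ ∀ U, w₀ Λ U ≤ B)
    (hosc : ∀ (Λ F : Finset (ZdEdge d)) (U U' : LGConfig d G), (∀ e ∉ F, U e = U' e) →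
      w₀ Λ U ≤ ENNReal.ofReal (Real.exp (K * F.card)) * w₀ Λ U')
    (k : ℕ) (Λ : Finset (ZdEdge d)) :
    (∫⁻ U, rgIterate M w₀ k (fineEdges M Λ) U ∂freeHaarConfig (fineEdges M Λ)) ≠ 0 ∧
      (∫⁻ U, rgIterate M w₀ k (fineEdges M Λ) U ∂freeHaarConfig (fineEdges M Λ)) ≠ ∞ := by
  obtain ⟨-, ⟨m, hm0, hml⟩, ⟨B, hBt, hBu⟩, -⟩ :=
    rgIterate_spec M hK hmeas hpos hbdd hosc k (fineEdges M Λ)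
  have hmZ : m ≤ ∫⁻ U, rgIterate M w₀ k (fineEdges M Λ) U ∂freeHaarConfig (fineEdges M Λ) := by
    calc m = ∫⁻ _, m ∂freeHaarConfig (G := G) (fineEdges M Λ) := by
          rw [lintegral_const, measure_univ, mul_one]
      _ ≤ _ := lintegral_mono fun U => hml U
  have hZB : (∫⁻ U, rgIterate M w₀ k (fineEdges M Λ) U ∂freeHaarConfig (fineEdges M Λ)) ≤ B := by
    calc _ ≤ ∫⁻ _, B ∂freeHaarConfig (G := G) (fineEdges M Λ) := lintegral_mono fun U => hBu U
      _ = B := by rw [lintegral_const, measure_univ, mul_one]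
  exact ⟨fun h => hm0 (le_zero_iff.1 (h ▸ hmZ)), ne_top_of_le_ne_top hBt hZB⟩

/-- The iterates from step `1` on have total mass one (`L = M ≥ 1`). [folklore] -/
theorem lintegral_rgIterate_succ (M : ℕ) [NeZero M] {w₀ : Finset (ZdEdge d) → LGConfig d G → ℝ≥0∞}
    {K : ℝ} (hK : 0 ≤ K) (hmeas : ∀ Λ, Measurable (w₀ Λ))
    (hpos : ∀ Λ, ∃ m : ℝ≥0∞, m ≠ 0 ∧ ∀ U, m ≤ w₀ Λ U)
    (hbdd : ∀ Λ, ∃ B : ℝ≥0∞, B ≠ ∞ ∧ ∀ U, w₀ Λ U ≤ B)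
    (hosc : ∀ (Λ F : Finset (ZdEdge d)) (U U' : LGConfig d G), (∀ e ∉ F, U e = U' e) →
      w₀ Λ U ≤ ENNReal.ofReal (Real.exp (K * F.card)) * w₀ Λ U')
    (k : ℕ) (Λ : Finset (ZdEdge d)) :
    ∫⁻ V, rgIterate M w₀ (k + 1) Λ V ∂freeHaarConfig Λ = 1 := by
  obtain ⟨hZ0, hZt⟩ := rgIterate_normaliser_ne M hK hmeas hpos hbdd hosc k Λ
  have hm := (rgIterate_spec M hK hmeas hpos hbdd hosc k (fineEdges M Λ)).1
  simp only [rgIterate_succ, ENNReal.div_eq_inv_mul]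
  rw [lintegral_const_mul _ (measurable_blockStepDensity M Λ hm), lintegral_blockStepDensity M Λ hm,
    ENNReal.inv_mul_cancel hZ0 hZt]

/-- **The iterates solve the normalised block RG recursion**: the block RG transform of
`ρ_k(fineEdges M Λ, ·) dU` is `Z_k(Λ) ρ_{k+1}(Λ, ·) dV` with
`Z_k(Λ) = ∫ ρ_k(fineEdges M Λ, U) dU` (pushforward formula `map_axialBlockHolonomy_withDensity`). [folklore] -/
theorem map_axialBlockHolonomy_withDensity_rgIterate (M : ℕ) [NeZero M]
    {w₀ : Finset (ZdEdge d) → LGConfig d G → ℝ≥0∞} {K : ℝ} (hK : 0 ≤ K)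
    (hmeas : ∀ Λ, Measurable (w₀ Λ))
    (hpos : ∀ Λ, ∃ m : ℝ≥0∞, m ≠ 0 ∧ ∀ U, m ≤ w₀ Λ U)
    (hbdd : ∀ Λ, ∃ B : ℝ≥0∞, B ≠ ∞ ∧ ∀ U, w₀ Λ U ≤ B)
    (hosc : ∀ (Λ F : Finset (ZdEdge d)) (U U' : LGConfig d G), (∀ e ∉ F, U e = U' e) →
      w₀ Λ U ≤ ENNReal.ofReal (Real.exp (K * F.card)) * w₀ Λ U')
    (k : ℕ) (Λ : Finset (ZdEdge d)) :
    ((freeHaarConfig (fineEdges M Λ)).withDensity (rgIterate M w₀ k (fineEdges M Λ))).map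
        (axialBlockHolonomy M) =
      (freeHaarConfig Λ).withDensity fun V =>
        (∫⁻ U, rgIterate M w₀ k (fineEdges M Λ) U ∂freeHaarConfig (fineEdges M Λ)) *
          rgIterate M w₀ (k + 1) Λ V := by
  obtain ⟨hZ0, hZt⟩ := rgIterate_normaliser_ne M hK hmeas hpos hbdd hosc k Λ
  have hm := (rgIterate_spec M hK hmeas hpos hbdd hosc k (fineEdges M Λ)).1
  rw [map_axialBlockHolonomy_withDensity M Λ hm]
  congr 1
  funext V
  rw [rgIterate_succ, ENNReal.mul_div_cancel hZ0 hZt]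

/-- **Uniform two-sided bounds on the iterates from step `1` on**: `e^{-K|Λ|} ≤ ρ_k(Λ, V) ≤ e^{K|Λ|}`
for every `k ≥ 1`, every finite coarse volume `Λ` and **every** coarse field `V`, with the
oscillation constant `K` of the starting weights (`bounds_of_osc_of_lintegral_eq_one`). [folklore] -/
theorem rgIterate_succ_bounds (M : ℕ) [NeZero M] {w₀ : Finset (ZdEdge d) → LGConfig d G → ℝ≥0∞}
    {K : ℝ} (hK : 0 ≤ K) (hmeas : ∀ Λ, Measurable (w₀ Λ))
    (hpos : ∀ Λ, ∃ m : ℝ≥0∞, m ≠ 0 ∧ ∀ U, m ≤ w₀ Λ U)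
    (hbdd : ∀ Λ, ∃ B : ℝ≥0∞, B ≠ ∞ ∧ ∀ U, w₀ Λ U ≤ B)
    (hosc : ∀ (Λ F : Finset (ZdEdge d)) (U U' : LGConfig d G), (∀ e ∉ F, U e = U' e) →
      w₀ Λ U ≤ ENNReal.ofReal (Real.exp (K * F.card)) * w₀ Λ U')
    (k : ℕ) (Λ : Finset (ZdEdge d)) (V : LGConfig d G) :
    ENNReal.ofReal (Real.exp (-(K * Λ.card))) ≤ rgIterate M w₀ (k + 1) Λ V ∧
      rgIterate M w₀ (k + 1) Λ V ≤ ENNReal.ofReal (Real.exp (K * Λ.card)) := by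
  obtain ⟨hm, -, -, ho⟩ := rgIterate_spec M hK hmeas hpos hbdd hosc (k + 1) Λ
  exact bounds_of_osc_of_lintegral_eq_one Λ hm (fun V V' h => rgIterate_succ_congr M w₀ k Λ h) ho
    (lintegral_rgIterate_succ M hK hmeas hpos hbdd hosc k Λ) V

end Iterate


/-! ### The Wilson starting weight -/

section WilsonWeight

variable [Group G] (ρ : G →* Matrix (Fin N) (Fin N) ℂ)

/-- The **Wilson weight** `exp (-β S_Λ(U))` of the finite edge volume `Λ` at inverse coupling
`β`, as an `ℝ≥0∞`-valued weight (the starting density `BlockRGScheme.effDensity_zero` with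
`β = g₀⁻²`). [folklore] -/
def wilsonBoltzmannWeight (β : ℝ) (Λ : Finset (ZdEdge d)) (U : LGConfig d G) : ℝ≥0∞ :=
  ENNReal.ofReal (Real.exp (-(β * wilsonBoundaryAction ρ Λ U)))

/-- The Wilson weight is finite. [folklore] -/
theorem wilsonBoltzmannWeight_ne_top (β : ℝ) (Λ : Finset (ZdEdge d)) (U : LGConfig d G) :
    wilsonBoltzmannWeight ρ β Λ U ≠ ∞ := ENNReal.ofReal_ne_top

/-- The real Wilson weight is recovered from the `ℝ≥0∞`-valued one. [folklore] -/
theorem toReal_wilsonBoltzmannWeight (β : ℝ) (Λ : Finset (ZdEdge d)) (U : LGConfig d G) :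
    (wilsonBoltzmannWeight ρ β Λ U).toReal = Real.exp (-(β * wilsonBoundaryAction ρ Λ U)) :=
  ENNReal.toReal_ofReal (Real.exp_nonneg _)

variable [TopologicalSpace G]

/-- For a continuous representation of a compact group the plaquette observables are bounded
uniformly in the plaquette and the configuration (`|Re tr ρ(g)|` is bounded on `G`). [folklore] -/
theorem exists_forall_abs_plaquetteObs_le [CompactSpace G] (hρ : Continuous ρ) :
    ∃ C : ℝ, 0 ≤ C ∧ ∀ (x : Site d) (i j : Fin d) (U : LGConfig d G),
      |plaquetteObs ρ x i j U| ≤ C := by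
  have hc : Continuous fun g : G => |((ρ g).trace).re| :=
    continuous_abs.comp (Complex.continuous_re.comp (Continuous.matrix_trace hρ))
  obtain ⟨C, hC⟩ := (isCompact_univ.image hc).isBounded.bddAbove
  refine ⟨max C 0, le_max_right _ _, fun x i j U => le_trans ?_ (le_max_left _ _)⟩
  exact hC ⟨plaquetteHolonomyZd U x i j, Set.mem_univ _, rfl⟩

variable [IsTopologicalGroup G]

/-- Continuity of the plaquette observable of a continuous representation (local copy of
`continuous_plaquetteObs` of `ContinuumLimitLGT`, to keep the import closure small). [folklore] -/
private theorem continuous_plaquetteObs_aux (hρ : Continuous ρ) (x : Site d) (i j : Fin d) :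
    Continuous (plaquetteObs (G := G) ρ x i j) := by
  unfold plaquetteObs plaquetteHolonomyZd
  refine Complex.continuous_re.comp (Continuous.matrix_trace (hρ.comp ?_))
  fun_prop

/-- The boundary Wilson action of a continuous representation is continuous in the
configuration (a finite sum of plaquette observables; local copy of
`continuous_wilsonBoundaryAction` of `LatticeGaugeDLRGibbsProofs`, whose import closure is
heavier). [folklore] -/
private theorem continuous_wilsonBoundaryAction_aux (hρ : Continuous ρ) (Λ : Finset (ZdEdge d)) :
    Continuous (wilsonBoundaryAction (G := G) ρ Λ) := by
  unfold wilsonBoundaryAction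
  exact continuous_finsetSum _ fun p _ =>
    continuous_const.sub (continuous_plaquetteObs_aux ρ hρ _ _ _)

variable [MeasurableSpace G] [BorelSpace G] [SecondCountableTopology G]

/-- The Wilson weight of a continuous representation is measurable. [folklore] -/
theorem measurable_wilsonBoltzmannWeight (hρ : Continuous ρ) (β : ℝ) (Λ : Finset (ZdEdge d)) :
    Measurable (wilsonBoltzmannWeight (G := G) ρ β Λ) :=
  ENNReal.measurable_ofReal.comp <| Real.measurable_exp.comp <|
    ((continuous_wilsonBoundaryAction_aux ρ hρ Λ).measurable.const_mul β).neg

variable [CompactSpace G]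

/-- **The Wilson weight is an admissible starting weight**: for a continuous representation of a
compact group and `β ≥ 0` there is a constant `K ≥ 0` (explicitly
`K = β (N + 3C) (1 + d) · #{i < j}` with `|Re tr ρ(U_p)| ≤ C`) such that every `exp (-β S_Λ)` is
measurable, pinched between `e^{-K|Λ|}` and `e^{K|Λ|}`, and changes by at most a factor
`e^{K|F|}` when the configuration is changed on a finite edge set `F` — uniformly in the volume
`Λ` (plaquette counting: `card_plaquettesTouching_le`, `abs_wilsonBoundaryAction_sub_le`). [folklore] -/
theorem wilsonBoltzmannWeight_spec (hρ : Continuous ρ) {β : ℝ} (hβ : 0 ≤ β) :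
    ∃ K : ℝ, 0 ≤ K ∧
      (∀ Λ : Finset (ZdEdge d), Measurable (wilsonBoltzmannWeight (G := G) ρ β Λ)) ∧
      (∀ Λ : Finset (ZdEdge d), ∃ m : ℝ≥0∞, m ≠ 0 ∧
        ∀ U : LGConfig d G, m ≤ wilsonBoltzmannWeight ρ β Λ U) ∧
      (∀ Λ : Finset (ZdEdge d), ∃ B : ℝ≥0∞, B ≠ ∞ ∧
        ∀ U : LGConfig d G, wilsonBoltzmannWeight ρ β Λ U ≤ B) ∧
      (∀ (Λ F : Finset (ZdEdge d)) (U U' : LGConfig d G), (∀ e ∉ F, U e = U' e) →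
        wilsonBoltzmannWeight ρ β Λ U ≤
          ENNReal.ofReal (Real.exp (K * F.card)) * wilsonBoltzmannWeight ρ β Λ U') ∧
      (∀ (Λ : Finset (ZdEdge d)) (U : LGConfig d G),
        Real.exp (-(K * Λ.card)) ≤ (wilsonBoltzmannWeight ρ β Λ U).toReal ∧
          (wilsonBoltzmannWeight ρ β Λ U).toReal ≤ Real.exp (K * Λ.card)) := by
  obtain ⟨C, hC0, hC⟩ := exists_forall_abs_plaquetteObs_le (d := d) ρ hρ
  set cd : ℝ := (((1 + d) * Fintype.card {p : Fin d × Fin d // p.1 < p.2} : ℕ) : ℝ) with hcd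
  have hcd0 : 0 ≤ cd := by positivity
  have hPT : ∀ F : Finset (ZdEdge d), ((plaquettesTouching F).card : ℝ) ≤ cd * F.card := by
    intro F
    have := card_plaquettesTouching_le F
    rw [hcd]
    exact_mod_cast this
  set K : ℝ := β * (N + 3 * C) * cd with hK
  have hN : (0 : ℝ) ≤ N := Nat.cast_nonneg N
  have hK0 : 0 ≤ K := by positivity
  -- |β S_Λ(U)| ≤ K |Λ|
  have hS : ∀ (Λ : Finset (ZdEdge d)) (U : LGConfig d G),
      |β * wilsonBoundaryAction ρ Λ U| ≤ K * Λ.card := by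
    intro Λ U
    rw [abs_mul, abs_of_nonneg hβ]
    calc β * |wilsonBoundaryAction ρ Λ U| ≤ β * ((N + C) * (plaquettesTouching Λ).card) :=
          mul_le_mul_of_nonneg_left (abs_wilsonBoundaryAction_le ρ hC Λ U) hβ
      _ ≤ β * ((N + 3 * C) * (cd * Λ.card)) := by
          gcongr
          · linarith
          · exact hPT Λ
      _ = K * Λ.card := by rw [hK]; ring
  -- oscillation of β S_Λ
  have hO : ∀ (Λ F : Finset (ZdEdge d)) (U U' : LGConfig d G), (∀ e ∉ F, U e = U' e) →
      -(β * wilsonBoundaryAction ρ Λ U) ≤ K * F.card + -(β * wilsonBoundaryAction ρ Λ U') := by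
    intro Λ F U U' hU
    have h1 := abs_wilsonBoundaryAction_sub_le ρ hC0 hC Λ F hU
    have h2 : β * (wilsonBoundaryAction ρ Λ U' - wilsonBoundaryAction ρ Λ U) ≤ K * F.card := by
      calc β * (wilsonBoundaryAction ρ Λ U' - wilsonBoundaryAction ρ Λ U)
            ≤ β * (2 * C * (plaquettesTouching F).card) :=
            mul_le_mul_of_nonneg_left (by linarith [(abs_le.1 h1).1]) hβ
        _ ≤ β * ((N + 3 * C) * (cd * F.card)) := by
            gcongr
            · linarith
            · exact hPT F
        _ = K * F.card := by rw [hK]; ring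
    linarith
  refine ⟨K, hK0, fun Λ => measurable_wilsonBoltzmannWeight ρ hρ β Λ, fun Λ => ?_, fun Λ => ?_,
    fun Λ F U U' hU => ?_, fun Λ U => ?_⟩
  · refine ⟨ENNReal.ofReal (Real.exp (-(K * Λ.card))), (ENNReal.ofReal_pos.2 (Real.exp_pos _)).ne',
      fun U => ENNReal.ofReal_le_ofReal (Real.exp_le_exp.2 ?_)⟩
    linarith [(abs_le.1 (hS Λ U)).2]
  · refine ⟨ENNReal.ofReal (Real.exp (K * Λ.card)), ENNReal.ofReal_ne_top,
      fun U => ENNReal.ofReal_le_ofReal (Real.exp_le_exp.2 ?_)⟩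
    linarith [(abs_le.1 (hS Λ U)).1]
  · unfold wilsonBoltzmannWeight
    rw [← ENNReal.ofReal_mul (Real.exp_nonneg _), ← Real.exp_add]
    exact ENNReal.ofReal_le_ofReal (Real.exp_le_exp.2 (hO Λ F U U' hU))
  · rw [toReal_wilsonBoltzmannWeight]
    exact ⟨Real.exp_le_exp.2 (by linarith [(abs_le.1 (hS Λ U)).2]),
      Real.exp_le_exp.2 (by linarith [(abs_le.1 (hS Λ U)).1])⟩

end WilsonWeight

/-! ### The Haar-iterate scheme: a block RG scheme solving the normalised recursion with
`k`-uniform two-sided bounds -/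

namespace BlockRGScheme

variable [Group G] [MeasurableSpace G] [TopologicalSpace G] [IsTopologicalGroup G]
  [CompactSpace G] [BorelSpace G]

/-- **The Haar-iterate block RG scheme** with block size `M ≥ 2`, representation `ρ` and running
couplings `g`: its effective densities are the normalised block RG iterates (`rgIterate`) of the
Wilson weight `exp (-g₀⁻² S_Λ)` under the free-boundary axial-gauge block RG step of prelude A18
(`IsBlockRGStepOf`), i.e. `ρ_{k+1}(Λ, V) ∝ ∫ ∏_{b ∈ Λ} δ(V_b⁻¹ Ū_b) ρ_k(fineEdges M Λ, U) dU`
realised by the everywhere-defined version `blockStepDensity` (Bałaban CMP 109 (1987) (0.1)–(0.2),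
without small/large-field split or coupling renormalisation — the v0 recursion
`IsRGIterateWith`). [folklore] -/
def haarIterate (M : ℕ) (hM : 2 ≤ M) (ρ : G →* Matrix (Fin N) (Fin N) ℂ) (g : RunningCouplings) :
    BlockRGScheme d N G where
  M := M
  two_le_M := hM
  ρ := ρ
  couplings := g
  effDensity k Λ U := (rgIterate M (wilsonBoltzmannWeight ρ ((g 0)⁻¹ ^ 2)) k Λ U).toReal
  effDensity_zero Λ U := by
    rw [rgIterate_zero]
    exact toReal_wilsonBoltzmannWeight ρ _ Λ U

/-- The free-energy normalisations `E_k(Λ) = -log ∫ ρ_k(fineEdges M Λ, U) dU` of the Haar-iterate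
scheme (vacuum energy plus free-boundary surface terms; see `IsRGIterateWith`). [folklore] -/
def haarIterateNormalisation (M : ℕ) (ρ : G →* Matrix (Fin N) (Fin N) ℂ) (g : RunningCouplings) :
    ℕ → Finset (ZdEdge d) → ℝ := fun k Λ =>
  -Real.log (∫⁻ U, rgIterate M (wilsonBoltzmannWeight ρ ((g 0)⁻¹ ^ 2)) k (fineEdges M Λ) U
    ∂freeHaarConfig (G := G) (fineEdges M Λ)).toReal

/-- The block size of the Haar-iterate scheme. [folklore] -/
@[simp] theorem haarIterate_M (M : ℕ) (hM : 2 ≤ M) (ρ : G →* Matrix (Fin N) (Fin N) ℂ)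
    (g : RunningCouplings) : (haarIterate (d := d) M hM ρ g).M = M := rfl

/-- The representation of the Haar-iterate scheme. [folklore] -/
@[simp] theorem haarIterate_ρ (M : ℕ) (hM : 2 ≤ M) (ρ : G →* Matrix (Fin N) (Fin N) ℂ)
    (g : RunningCouplings) : (haarIterate (d := d) M hM ρ g).ρ = ρ := rfl

/-- The running couplings of the Haar-iterate scheme. [folklore] -/
@[simp] theorem haarIterate_couplings (M : ℕ) (hM : 2 ≤ M) (ρ : G →* Matrix (Fin N) (Fin N) ℂ)
    (g : RunningCouplings) : (haarIterate (d := d) M hM ρ g).couplings = g := rfl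

/-- The effective densities of the Haar-iterate scheme are the normalised iterates of the Wilson
weight at `β = g₀⁻²`, converted to `ℝ`. [folklore] -/
theorem haarIterate_effDensity (M : ℕ) (hM : 2 ≤ M) (ρ : G →* Matrix (Fin N) (Fin N) ℂ)
    (g : RunningCouplings) (k : ℕ) (Λ : Finset (ZdEdge d)) (U : LGConfig d G) :
    (haarIterate M hM ρ g).effDensity k Λ U =
      (rgIterate M (wilsonBoltzmannWeight ρ ((g 0)⁻¹ ^ 2)) k Λ U).toReal := rfl

variable [SecondCountableTopology G]

/-- **The Haar-iterate scheme solves the normalised block RG recursion** `IsRGIterateWith` with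
the normalisations `haarIterateNormalisation` (pushforward formula
`map_axialBlockHolonomy_withDensity`; Bałaban CMP 109 (1987) (0.1)–(0.2) in the free-boundary
axial-gauge form of prelude A18). In particular the hypothesis structure of
`Literature.MathematicalPhysics.QuantumFieldTheory.BalabanUVStability3/4` at a fixed cutoff level
is inhabited by genuine RG iterates. [folklore] -/
theorem haarIterate_isRGIterateWith {M : ℕ} (hM : 2 ≤ M) (ρ : G →* Matrix (Fin N) (Fin N) ℂ)
    (hρ : Continuous ρ) (g : RunningCouplings) :
    (haarIterate (d := d) M hM ρ g).IsRGIterateWith (haarIterateNormalisation M ρ g) := by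
  haveI : NeZero M := ⟨by omega⟩
  obtain ⟨K, hK, hmeas, hpos, hbdd, hosc, -⟩ :=
    wilsonBoltzmannWeight_spec (d := d) (G := G) ρ hρ (sq_nonneg ((g 0)⁻¹))
  intro k Λ
  obtain ⟨hZ0, hZt⟩ := rgIterate_normaliser_ne M hK hmeas hpos hbdd hosc k Λ
  obtain ⟨-, -, ⟨B, hBt, hBu⟩, -⟩ := rgIterate_spec M hK hmeas hpos hbdd hosc k (fineEdges M Λ)
  obtain ⟨-, -, ⟨B', hBt', hBu'⟩, -⟩ := rgIterate_spec M hK hmeas hpos hbdd hosc (k + 1) Λ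
  set Z := ∫⁻ U, rgIterate M (wilsonBoltzmannWeight ρ ((g 0)⁻¹ ^ 2)) k (fineEdges M Λ) U
    ∂freeHaarConfig (G := G) (fineEdges M Λ) with hZ
  have hfin : ∀ U, rgIterate M (wilsonBoltzmannWeight ρ ((g 0)⁻¹ ^ 2)) k (fineEdges M Λ) U ≠ ∞ :=
    fun U => ne_top_of_le_ne_top hBt (hBu U)
  have hfin' : ∀ V, rgIterate M (wilsonBoltzmannWeight ρ ((g 0)⁻¹ ^ 2)) (k + 1) Λ V ≠ ∞ :=
    fun V => ne_top_of_le_ne_top hBt' (hBu' V)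
  unfold IsBlockRGStepOf
  dsimp only [haarIterate_M]
  have h1 : (fun U => ENNReal.ofReal ((haarIterate (d := d) M hM ρ g).effDensity k
      (fineEdges M Λ) U)) =
      rgIterate M (wilsonBoltzmannWeight ρ ((g 0)⁻¹ ^ 2)) k (fineEdges M Λ) := by
    funext U
    rw [haarIterate_effDensity, ENNReal.ofReal_toReal (hfin U)]
  have hE : Real.exp (-haarIterateNormalisation (G := G) M ρ g k Λ) = Z.toReal := by
    rw [haarIterateNormalisation, neg_neg, ← hZ, Real.exp_log (ENNReal.toReal_pos hZ0 hZt)]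
  have h2 : (fun V => ENNReal.ofReal (Real.exp (-haarIterateNormalisation (G := G) M ρ g k Λ) *
      (haarIterate M hM ρ g).effDensity (k + 1) Λ V)) =
      fun V => Z * rgIterate M (wilsonBoltzmannWeight ρ ((g 0)⁻¹ ^ 2)) (k + 1) Λ V := by
    funext V
    rw [hE, haarIterate_effDensity, ← ENNReal.toReal_mul,
      ENNReal.ofReal_toReal (ENNReal.mul_ne_top hZt (hfin' V))]
  rw [h1, h2]
  exact map_axialBlockHolonomy_withDensity_rgIterate M hK hmeas hpos hbdd hosc k Λ

/-- **Single-scheme uniform ultraviolet stability by Haar invariance** (review r02500B; the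
elementary statement behind the API predicate `HasUniformUVStability`): the Haar-iterate scheme of
a continuous representation of a compact (second countable) group satisfies
`e^{-K|Λ|} ≤ ρ_k(Λ, V) ≤ e^{K|Λ|}` for **all** `k`, all finite coarse volumes `Λ` and all coarse
fields `V`, with `K = g₀⁻² (N + 3C)(1 + d) #{i < j}` (`|Re tr ρ| ≤ C`) independent of `k`: the
oscillation estimate of the Wilson weight (`wilsonBoltzmannWeight_spec`) propagates through every block RG
step with the same constant (`rgIterate_spec`), and the iterates are probability densities
(`lintegral_rgIterate_succ`, `bounds_of_osc_of_lintegral_eq_one`). This is *not* Bałaban's theorem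
(CMP 102 (1985) Thm. 1), whose content is uniformity in the cutoff with cutoff-dependent bare
coupling (`BalabanUVStability3`); here `K` blows up like `g₀⁻²`. [folklore] -/
theorem haarIterate_hasUniformUVStability {M : ℕ} (hM : 2 ≤ M) (ρ : G →* Matrix (Fin N) (Fin N) ℂ)
    (hρ : Continuous ρ) (g : RunningCouplings) :
    (haarIterate (d := d) M hM ρ g).HasUniformUVStability := by
  haveI : NeZero M := ⟨by omega⟩
  obtain ⟨K, hK, hmeas, hpos, hbdd, hosc, h0⟩ :=
    wilsonBoltzmannWeight_spec (d := d) (G := G) ρ hρ (sq_nonneg ((g 0)⁻¹))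
  refine ⟨K, K, fun k j _ Λ V => ?_⟩
  rw [haarIterate_effDensity]
  cases j with
  | zero => simpa using h0 Λ V
  | succ j =>
    obtain ⟨-, -, ⟨B, hBt, hBu⟩, -⟩ := rgIterate_spec M hK hmeas hpos hbdd hosc (j + 1) Λ
    have hfin : rgIterate M (wilsonBoltzmannWeight ρ ((g 0)⁻¹ ^ 2)) (j + 1) Λ V ≠ ∞ :=
      ne_top_of_le_ne_top hBt (hBu V)
    obtain ⟨hl, hu⟩ := rgIterate_succ_bounds M hK hmeas hpos hbdd hosc j Λ V
    exact ⟨(ENNReal.ofReal_le_iff_le_toReal hfin).1 hl,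
      ENNReal.toReal_le_of_le_ofReal (Real.exp_nonneg _) hu⟩

/-- The Haar-iterate scheme is uniformly UV stable in the a.e. sense as well. [folklore] -/
theorem haarIterate_hasUniformUVStabilityAE {M : ℕ} (hM : 2 ≤ M)
    (ρ : G →* Matrix (Fin N) (Fin N) ℂ) (hρ : Continuous ρ) (g : RunningCouplings) :
    (haarIterate (d := d) M hM ρ g).HasUniformUVStabilityAE :=
  (haarIterate_hasUniformUVStability hM ρ hρ g).ae _

/-- **Existence of uniformly UV stable solutions of the normalised block RG recursion** (the
corrected, closed form of the folklore claim in the docstring of `HasUniformUVStability`, review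
r02500B): for every block size `M ≥ 2`, every continuous representation `ρ` of the compact second
countable gauge group `G` and every sequence of running couplings `g`, there is a block RG scheme
with exactly these data whose effective densities are normalised block RG iterates of the Wilson
density (`IsRGIterateWith E` for suitable free-energy normalisations `E`) and which is uniformly
UV stable, pointwise and a.e. Contrast: the predicates `HasUniformUVStability(AE)` fail for other
schemes with the same data (`exists_not_hasUniformUVStability(AE)`, `ConstructiveQFTBalabanRGProofs`),
and Bałaban's theorems (`BalabanUVStability3/4`) concern uniformity in the cutoff, which this
elementary bound (constant `∝ g₀⁻²`) does not give. [folklore] -/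
theorem exists_isRGIterateWith_and_hasUniformUVStability {M : ℕ} (hM : 2 ≤ M)
    (ρ : G →* Matrix (Fin N) (Fin N) ℂ) (hρ : Continuous ρ) (g : RunningCouplings) :
    ∃ sch : BlockRGScheme d N G, sch.M = M ∧ sch.ρ = ρ ∧ sch.couplings = g ∧
      (∃ E, sch.IsRGIterateWith E) ∧ sch.HasUniformUVStability ∧ sch.HasUniformUVStabilityAE :=
  ⟨haarIterate M hM ρ g, rfl, rfl, rfl, ⟨_, haarIterate_isRGIterateWith hM ρ hρ g⟩,
    haarIterate_hasUniformUVStability hM ρ hρ g, haarIterate_hasUniformUVStabilityAE hM ρ hρ g⟩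

end BlockRGScheme

end Literature.MathematicalPhysics.QuantumLattice
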